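import Summits.ResolutionOfSingularities.ResolutionOfSingularities.Theorems.UniversalCellsMatroidCellResChartReduction
import Literature.AlgebraicGeometry.Resolution.HuGammaSchemeResolution
import HarnessLib

/-!
# `UniversalCells.MatroidCellRes` modulo Hu's claim and modulo Cossart–Piltant (crux stmt-ResolutionOfSingularities-15230)

The chart reduction `matroidCellRes_of_saturatedEngine`
(`UniversalCellsMatroidCellResChartReduction.lean`) composed with the two NAMED inputs the line
`birth` of the crux uses (`Cruxes/MatroidCellRes/Lines/birth.lean`, RESHAPE 4d):

* Hu's CLAIM `Literature.AlgebraicGeometry.Resolution.Hu2025IntegralGammaSchemeResolution`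
  (Hu 2025, arXiv:2507.21400, Thm. 1.3, unrefereed, `@[claim]`): INTEGRAL Γ-schemes `Z_Γ` over `𝔽_p`
  have resolutions. It resolves every principal chart of an integral `Z_Γ` by restriction
  (`hasResolution_away_of_hu2025`), so GIVEN the claim the saturated engine shrinks to its charts
  of NON-integral Γ-schemes — the line's residue stub (N) `stub_saturatedEngineNonintegral` — and
  `matroidCellRes_of_hu2025_of_residue : claim → (N) → MatroidCellRes` is the registered
  composition of the line, now a tree theorem (CONDITIONAL on the claim by design: it records
  exactly what is open).
* Cossart–Piltant's refereed theorem `Literature.AlgebraicGeometry.Resolution.CossartPiltant2019`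
  (named fact, not formalised): reduced separated finite-type schemes of dimension `≤ 3` over a
  field have resolutions. It resolves the charts of dimension `≤ 3`
  (`hasResolution_away_of_dim_le_three`), so MODULO it the engine is needed only from dimension
  `4` on — the open frontier of resolution in positive characteristic
  (barrier `Literature.Barriers.ResolutionOfSingularities.DimensionFourFrontier`):
  `matroidCellRes_of_cossartPiltant_of_saturatedEngineDimGeFour`.

No definition is declared; hypotheses are inline over `tautMatrix` / `minorIdeal`
(`Theorems/UniversalCellsDefs.lean`). Every theorem taking a named fact is conditional on it and
says so.
-/

noncomputable section

-- single-problem summit: the doubled namespace component `ResolutionOfSingularities` is forced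
set_option linter.dupNamespace false

open CategoryTheory AlgebraicGeometry Literature.AlgebraicGeometry.Resolution
open Summit.ResolutionOfSingularities.ResolutionOfSingularities.Theses.UniversalCells (MatroidCellRes)
open Summit.ResolutionOfSingularities.ResolutionOfSingularities.Theorems.UniversalCells
  (tautMatrix minorIdeal)

namespace Summit.ResolutionOfSingularities.ResolutionOfSingularities.Theorems.MatroidCellRes

/-! ## Charts resolved by the two named inputs -/

/-- **Charts of INTEGRAL Γ-schemes, from Hu's claim**: if the whole coordinate ring
`Q_Γ = 𝔽_p[A] ⧸ (Γ-minors)` is a domain, every principal open `Spec (Q_Γ)_g` has a resolution —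
Hu's claim resolves `Z_Γ = Spec Q_Γ` (`Hu2025IntegralGammaSchemeResolution.hasResolution`; the
Literature ring `HuGamma.ring (ZMod p) m Γ` is this quotient by `rfl`) and resolutions restrict
along the localisation open immersion (`Scheme.HasResolution.of_isOpenImmersion`). CONDITIONAL on
the claim. [cite: Hu2025, Thm. 1.3 (p. 8)] -/
theorem hasResolution_away_of_hu2025 (hH : Hu2025IntegralGammaSchemeResolution)
    (p : ℕ) [Fact p.Prime] (m : ℕ) (Γ : Set (Fin 3 → Fin 3 ⊕ Fin m))
    (hQ : IsDomain (MvPolynomial (Fin 3 × Fin m) (ZMod p) ⧸ minorIdeal p m Γ))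
    (g : MvPolynomial (Fin 3 × Fin m) (ZMod p) ⧸ minorIdeal p m Γ) :
    Scheme.HasResolution (Spec (.of (Localization.Away g))) := by
  have h1 : Scheme.HasResolution
      (Spec (.of (MvPolynomial (Fin 3 × Fin m) (ZMod p) ⧸ minorIdeal p m Γ))) :=
    Hu2025IntegralGammaSchemeResolution.hasResolution hH p m Γ hQ
  haveI : IsOpenImmersion (Spec.map (CommRingCat.ofHom (algebraMap
      (MvPolynomial (Fin 3 × Fin m) (ZMod p) ⧸ minorIdeal p m Γ) (Localization.Away g)))) :=
    IsOpenImmersion.of_isLocalization g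
  exact Scheme.HasResolution.of_isOpenImmersion (Spec.map (CommRingCat.ofHom (algebraMap
    (MvPolynomial (Fin 3 × Fin m) (ZMod p) ⧸ minorIdeal p m Γ) (Localization.Away g)))) h1

/-- **Charts of dimension `≤ 3`, from Cossart–Piltant by name**: an integral principal open
`Spec (𝔽_p[A] ⧸ I)_g` is a reduced, separated `𝔽_p`-scheme of finite type
(`locallyOfFiniteType_away`), so if its topological Krull dimension is `≤ 3` the named fact
`CossartPiltant2019` resolves it (`hasResolution_of_dim_le_three`). CONDITIONAL on that fact.
[cite: CossartPiltant2019, Thm. 1.1] -/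
theorem hasResolution_away_of_dim_le_three (hCP : CossartPiltant2019.{0})
    (p : ℕ) [Fact p.Prime] (m : ℕ) (I : Ideal (MvPolynomial (Fin 3 × Fin m) (ZMod p)))
    (g : MvPolynomial (Fin 3 × Fin m) (ZMod p) ⧸ I) (hdom : IsDomain (Localization.Away g))
    (hdim : topologicalKrullDim (Spec (.of (Localization.Away g))) ≤ 3) :
    Scheme.HasResolution (Spec (.of (Localization.Away g))) := by
  let f : Spec (.of (Localization.Away g)) ⟶ Spec (.of (ZMod p)) :=
    Spec.map (CommRingCat.ofHom (algebraMap (ZMod p) (Localization.Away g)))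
  haveI hft : LocallyOfFiniteType f := locallyOfFiniteType_away p m I g
  haveI : IsSeparated f := inferInstance
  haveI : QuasiCompact f := inferInstance
  haveI : _root_.IsReduced (Localization.Away g) := isReduced_of_noZeroDivisors
  haveI : IsReduced (Spec (.of (Localization.Away g))) := inferInstance
  exact hasResolution_of_dim_le_three hCP (p := p) (ZMod p) (Spec (.of (Localization.Away g))) f hdim

/-! ## The crux modulo Hu's claim: the residue (N) -/

/-- **`MatroidCellRes` from Hu's claim and the residue (N)** — the registered composition of line
`birth` (`MatroidCellRes_of`, RESHAPE 4d), as a tree theorem: given the claim, charts of integral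
Γ-schemes are resolved by `hasResolution_away_of_hu2025`; the remaining singular saturated
integral charts of dimension `≥ 2` of NON-integral Γ-schemes are exactly the hypothesis (N)
(verbatim the registered stub `stub_saturatedEngineNonintegral` over `minorIdeal`/`tautMatrix`);
then `matroidCellRes_of_saturatedEngine`. CONDITIONAL on Hu's unrefereed claim; (N) is open
(summit-implied: `saturatedEngine_of_resolutionOfSingularities`).
[cite: Hu2025, Thm. 1.3 (p. 8) and Lemma 7.3 (p. 58)] -/
theorem matroidCellRes_of_hu2025_of_residue (hH : Hu2025IntegralGammaSchemeResolution)
    (hN : ∀ p : ℕ, p.Prime → ∀ (m : ℕ) (Γ : Set (Fin 3 → Fin 3 ⊕ Fin m)),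
      ¬ IsDomain (MvPolynomial (Fin 3 × Fin m) (ZMod p) ⧸ minorIdeal p m Γ) →
      ∀ (g : MvPolynomial (Fin 3 × Fin m) (ZMod p) ⧸ minorIdeal p m Γ),
        IsDomain (Localization.Away g) →
          (∀ u : Fin 3 → Fin 3 ⊕ Fin m, u ∉ Γ →
            algebraMap (MvPolynomial (Fin 3 × Fin m) (ZMod p) ⧸ minorIdeal p m Γ)
              (Localization.Away g)
              (Ideal.Quotient.mk (minorIdeal p m Γ) ((tautMatrix p m).submatrix id u).det) ≠ 0) →
          ¬ IsRegularRing (Localization.Away g) →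
            ¬ topologicalKrullDim (Spec (.of (Localization.Away g))) ≤ 1 →
              Scheme.HasResolution (Spec (.of (Localization.Away g)))) :
    MatroidCellRes := by
  refine matroidCellRes_of_saturatedEngine fun p hp m Γ g hdom hsat hsing hdim => ?_
  haveI : Fact p.Prime := ⟨hp⟩
  by_cases hQ : IsDomain (MvPolynomial (Fin 3 × Fin m) (ZMod p) ⧸ minorIdeal p m Γ)
  · exact hasResolution_away_of_hu2025 hH p m Γ hQ g
  · exact hN p hp m Γ hQ g hdom hsat hsing hdim

/-! ## The crux modulo Cossart–Piltant: the engine from dimension 4 on -/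

/-- **`MatroidCellRes` from Cossart–Piltant by name and the saturated engine in dimension `≥ 4`**
(lead c2's RESHAPE 4c composition as a tree theorem): charts that are regular, of dimension `≤ 1`
(normalisation) or of dimension `≤ 3` (`hasResolution_away_of_dim_le_three`) are disposed of; the
hypothesis is the saturated engine on the SINGULAR charts of dimension `≥ 4` — resolution in
positive characteristic at its open frontier, met on Hu's family. CONDITIONAL on the named fact
`CossartPiltant2019`; the engine is open (summit-implied).
[cite: CossartPiltant2019, Thm. 1.1; Hu2025, Thm. 1.3 (p. 8)] -/
theorem matroidCellRes_of_cossartPiltant_of_saturatedEngineDimGeFour (hCP : CossartPiltant2019.{0})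
    (hE : ∀ p : ℕ, p.Prime → ∀ (m : ℕ) (Γ : Set (Fin 3 → Fin 3 ⊕ Fin m))
      (g : MvPolynomial (Fin 3 × Fin m) (ZMod p) ⧸ minorIdeal p m Γ),
      IsDomain (Localization.Away g) →
        (∀ u : Fin 3 → Fin 3 ⊕ Fin m, u ∉ Γ →
          algebraMap (MvPolynomial (Fin 3 × Fin m) (ZMod p) ⧸ minorIdeal p m Γ)
            (Localization.Away g)
            (Ideal.Quotient.mk (minorIdeal p m Γ) ((tautMatrix p m).submatrix id u).det) ≠ 0) →
        ¬ IsRegularRing (Localization.Away g) →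
          ¬ topologicalKrullDim (Spec (.of (Localization.Away g))) ≤ 3 →
            Scheme.HasResolution (Spec (.of (Localization.Away g)))) :
    MatroidCellRes := by
  refine matroidCellRes_of_saturatedEngine fun p hp m Γ g hdom hsat hsing _ => ?_
  haveI : Fact p.Prime := ⟨hp⟩
  by_cases hdim3 : topologicalKrullDim (Spec (.of (Localization.Away g))) ≤ 3
  · exact hasResolution_away_of_dim_le_three hCP p m (minorIdeal p m Γ) g hdom hdim3
  · exact hE p hp m Γ g hdom hsat hsing hdim3

/-- **Both named inputs at once**: given Hu's claim AND Cossart–Piltant, `MatroidCellRes` reduces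
to the saturated engine on singular charts of dimension `≥ 4` of NON-integral Γ-schemes — the
sharpest residue the line `birth` reaches (lead c2's stub (N) of RESHAPE 4c). CONDITIONAL on both.
[cite: Hu2025, Thm. 1.3 (p. 8); CossartPiltant2019, Thm. 1.1] -/
theorem matroidCellRes_of_hu2025_of_cossartPiltant_of_residueDimGeFour
    (hH : Hu2025IntegralGammaSchemeResolution) (hCP : CossartPiltant2019.{0})
    (hN : ∀ p : ℕ, p.Prime → ∀ (m : ℕ) (Γ : Set (Fin 3 → Fin 3 ⊕ Fin m)),
      ¬ IsDomain (MvPolynomial (Fin 3 × Fin m) (ZMod p) ⧸ minorIdeal p m Γ) →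
      ∀ (g : MvPolynomial (Fin 3 × Fin m) (ZMod p) ⧸ minorIdeal p m Γ),
        IsDomain (Localization.Away g) →
          (∀ u : Fin 3 → Fin 3 ⊕ Fin m, u ∉ Γ →
            algebraMap (MvPolynomial (Fin 3 × Fin m) (ZMod p) ⧸ minorIdeal p m Γ)
              (Localization.Away g)
              (Ideal.Quotient.mk (minorIdeal p m Γ) ((tautMatrix p m).submatrix id u).det) ≠ 0) →
          ¬ IsRegularRing (Localization.Away g) →
            ¬ topologicalKrullDim (Spec (.of (Localization.Away g))) ≤ 3 →
              Scheme.HasResolution (Spec (.of (Localization.Away g)))) :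
    MatroidCellRes := by
  refine matroidCellRes_of_cossartPiltant_of_saturatedEngineDimGeFour hCP
    fun p hp m Γ g hdom hsat hsing hdim => ?_
  haveI : Fact p.Prime := ⟨hp⟩
  by_cases hQ : IsDomain (MvPolynomial (Fin 3 × Fin m) (ZMod p) ⧸ minorIdeal p m Γ)
  · exact hasResolution_away_of_hu2025 hH p m Γ hQ g
  · exact hN p hp m Γ hQ g hdom hsat hsing hdim

end Summit.ResolutionOfSingularities.ResolutionOfSingularities.Theorems.MatroidCellRes

end
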